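import Literature.MathematicalPhysics.QuantumFieldTheory.Balaban1983to89.B2Eq265ConstantPart

/-!
# `Balaban1983to89.B2Eq265CentredBox` — [Balaban1982Higgs2] Lemma 2.4 (2.65) p.572 on the (Higgs)₂,₃ carrier of record with print's
# `□₁` (p.572, AS PRINTED, render re-read by the row owner r02 2026-08-23: «Let us define □₁, □₂ as the sums of large blocks contained in
# Λ₇^{(k−1)′} and distant from the point y less than 2r(Lᵏε), 4r(Lᵏε) respectively, and let us denote □ = Bᵏ(□₂). Of course
# □ ⊂ Bᵏ(Λ₂^{(k−1)′}).») READ as the cube of coarse sites of radius `R₁` CENTRED AT `ȳ` — so `dist(ȳ, T^{(k)} ∖ □₁) ≥ R₁ + 1` is PROVED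
# and the binder `ρ` disappears — and with the regularity of `A^{(k)}` entering through ONE small-gradient hypothesis on `B^k(Λ₂)`
# («property (2.60)»), the (I.2.23)-form hypothesis of (2.67) being DERIVED from it (`eq265_higgs_region_centred`)

statement-level skeleton of published theorems with citation tags; proofs where landed; nothing here is a claim
about the Yang–Mills mass gap

PDF held: `paper:balaban1982-cmp86-higgs23-ii` (journal page = PDF page + 554), p. 572 [PDF 18] (text layer p0018 L4–15).

CITATION HEADER (lean-in-tree rule).  T. Bałaban, *(Higgs)₂,₃ quantum fields in a finite volume. II. An upper bound*,
Commun. Math. Phys. **86** (1982) 555–594, doi:10.1007/bf01214890 [Balaban1982Higgs2].  Cell `lit-balaban` (HOME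
`run/shared/lean/pub/lit-balaban/`), Phase-2 proof seat **p23** gen 21 (unit `lit-balaban-p23-g21`; free-target protocol G.5-34(d), TAKING #8
line HOME/STATUS.md 2026-08-23); SKELETON row **B2.Lem2.4** (fold owner r02, second reader r14; head `proved p250408 · …` UNCHANGED —
cells-only member, brick F8 of the seat's programme).  USED BY NAME, never restated: own F7 `B2Eq265ConstantPart.eq265_higgs_region_reg`,
the typer's `B2Eq255Concrete.{underRegion, mem_underRegion}`, `HiggsLattice.Site.tdist`, `HiggsAveraging.blockIter`.

THE ARGUMENT.  (1) If `□₁` is the box `q₁ + [0, 2R₁+1)ᵈ` of coarse sites and `ȳ` its centre (`n_ν(ȳ − q₁) = R₁`), then every coarse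
site outside `□₁` has torus distance `≥ R₁ + 1` from `ȳ` (`tdist_ge_of_not_mem_box`: one coordinate offset is `≥ 2R₁ + 1`, and both
residues `n(y_ν − ȳ_ν)`, `n(ȳ_ν − y_ν)` are then `≥ R₁ + 1`) — so F7's binder `ρ` is instantiated at `R₁ + 1` and `ȳ ∈ □₁` holds.
(2) The (I.2.23)-form regularity `(Lᵏε)|e|e_k⁻¹|A_{b′} − A_b| ≤ c_reg e_k^{β−1} L^{−k}` on `B^k(Λ₂)` used by (2.67) follows from the
small-gradient form `|A_{⟨z+e_ν,μ⟩} − A_{⟨z,μ⟩}| ≤ δA` on `B^k(Λ₂)` once `Lᵏ(Lᵏε)|e|δA ≤ c_reg e_k^β` (`reg223_of_grad`), and the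
small-gradient form on `□ = B^k(□₂) ⊆ B^k(Λ₂)` is its restriction.  Feeding both to F7's `eq265_higgs_region_reg` gives (2.65) with one
regularity hypothesis and no `ρ`.

WHAT THIS FILE PROVES (kernel-checked, zero `sorry`; theorems only — NO definition, NO `Prop`-valued fact; axioms standard).
 §1 `tdist_ge_of_not_mem_box`, `mem_box_of_centre` (the centred box), `reg223_of_grad` ((I.2.23)-form from the gradient bound).
 §2 **`eq265_higgs_region_centred`** — (2.65) value clause on the carrier: F7's statement word for word except (located edits) `□₁ :=`
    the box of radius `R₁` about `ȳ` (binders `q₁ R₁`, `2(2R₁+1) ≤ |T^{(k)}|_μ`, `n_ν(ȳ − q₁) = R₁` replacing `ȳ ∈ □₁`), `ρ ↦ R₁ + 1`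
    (binder and hypothesis removed), and the two regularity hypotheses replaced by `|∂A| ≤ δA` on `B^k(Λ₂)` + `LᵏδA|e| ≤ t` +
    `Lᵏ(Lᵏε)|e|δA ≤ c_reg e_k^β` (`0 < e_k ≤ e₁`).

HONEST SCOPE / DIFFERENCES FROM PRINT (recorded, not hidden; one sentence each).  (a) `□₁` SHAPE: print's `□₁` is the sum of the LARGE
BLOCKS of `Λ₇^{(k−1)′}` within `2r(Lᵏε)` of the point `y` (big-block granularity, centred at print's `y`); here `□₁` is the sup-metric CUBE OF
COARSE SITES of radius `R₁` centred at `ȳ = x_k` (F6/F7's box binders `q₁, S₁` with `S₁ := 2R₁ + 1`) — the box-shape entry of the row's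
residue list is unchanged.  (b) `R₁ ⇐ 2r(Lᵏε)/(Lᵏε)` is NOT derived (the user's reading), and `□₁ ⊆ □₂ ∩ Λ₆` STAYS a hypothesis.
(c) `δA`'s RANGE: F7 asked the small-gradient form on `□ = B^k(□₂)` and the (I.2.23) form on `B^k(Λ₂)`; F8 asks the small-gradient form on
`B^k(Λ₂) ⊇ □` (print's own range for (2.60): «x ∈ Bᵏ(Λ₂^{(k−1)′})») and derives both; its size `LᵏδA = O(p(Lᵏε))` ⇐ (2.60) (row B2.Lem2.3,
`famTorus23` family — not fed by name, no bridge) is the user's.  (d) PROVENANCE OF THE CONSTANTS (none minted here): `c_reg, β` are free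
inputs (the user's (I.2.23) profile, as in own `B2Eq267HiggsRegion.eq267_higgs_region`), `e₁` is (2.67)'s coupling threshold from that file
(p35's regular-region (2.10) machinery underneath), `t` is F4′'s `B2Eq268HiggsRegion.row_sums_box` threshold (p35's
`B3Ineq210RegularBox.ineq210_regularBox_explicit_small`), `C₁ … D₄` as in F5.  (e) Everything else as in F7's HONEST SCOPE (value clause
only; `λ_A = ℓ ×` (2.55)₃'s quantity at `Ā^{(k)}`, `t′`, the `s`-reading via `δA`, `S ⇐ 4r(Lᵏε)`, the depth of `x`, base point the
corner).  NOT summit progress.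
-/

open scoped BigOperators

noncomputable section

namespace Literature.MathematicalPhysics.QuantumFieldTheory.Balaban1983to89.B2Eq265CentredBox

open HiggsLattice (ChargeData)
open HiggsAveraging (blockIter toFinest)
open HiggsCovariance (avgQkAdj)
open HiggsCovariancePos (Inside)
open B2Eq255Concrete (bgScalar256 underRegion mem_underRegion barA)
open B2Eq265ConstantPart (eq265_higgs_region_reg)
open B1Ineq225RegularBox (cellBox)
open B1Ineq234Concrete (distC)
open B1TorusRegionHSizes (IsBigBlockUnion)
open B1TorusCubeCover (half)
open B1TorusCubeLocality26 (rS)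

variable {P : HiggsLattice.Params} {N : ℕ} {k : ℕ}

/-! ## §1 The centred box and the regularity scalings -/

section CentredBox

/-- **outside the cube of radius `R₁` centred at `ȳ` every site is `≥ R₁ + 1` away** ((1.3) torus distance): if `n_ν(ȳ − q₁) = R₁` for
all `ν` and `y ∉ q₁ + [0, 2R₁+1)ᵈ`, then `R₁ + 1 ≤ |ȳ − y|`. [cite: Balaban1982Higgs2, Lemma 2.4 proof p.572 «Let us define □₁, □₂ as the sums of large blocks contained in Λ₇^{(k−1)′} and distant from the point y less than 2r(Lᵏε), 4r(Lᵏε) respectively, and let us denote □ = Bᵏ(□₂). Of course □ ⊂ Bᵏ(Λ₂^{(k−1)′}).»]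
[cite: Balaban1982Higgs1, (1.3) p.604] -/
theorem tdist_ge_of_not_mem_box (q₁ ybar : HiggsLattice.Site P k) (R₁ : ℕ) (hybar : ∀ ν : Fin P.d, (ybar ν - q₁ ν).val = R₁)
    {y : HiggsLattice.Site P k} (hy : ¬ ∀ ν : Fin P.d, (y ν - q₁ ν).val < 2 * R₁ + 1) :
    R₁ + 1 ≤ HiggsLattice.Site.tdist ybar y := by
  push Not at hy
  obtain ⟨ν, hν⟩ := hy
  haveI : NeZero (P.sitesPerDir k ν) := ⟨(P.sitesPerDir_pos k ν).ne'⟩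
  have ha : (y ν - q₁ ν).val < P.sitesPerDir k ν := ZMod.val_lt _
  have hR := hybar ν
  -- `n(y_ν − ȳ_ν) = n(y_ν − q₁_ν) − R₁ ≥ R₁ + 1`
  have e1 : y ν - ybar ν = (y ν - q₁ ν) - (ybar ν - q₁ ν) := by ring
  have h1 : (y ν - ybar ν).val = (y ν - q₁ ν).val - R₁ := by
    rw [e1, ZMod.val_sub (by rw [hR]; omega), hR]
  -- `n(ȳ_ν − y_ν) = |T| − n(y_ν − ȳ_ν) ≥ R₁ + 1`
  have hne : y ν - ybar ν ≠ 0 := by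
    intro h0
    have := congrArg ZMod.val h0
    rw [h1, ZMod.val_zero] at this
    omega
  have h2 : (ybar ν - y ν).val = P.sitesPerDir k ν - (y ν - ybar ν).val := by
    rw [← neg_sub, ZMod.neg_val, if_neg hne]
  unfold HiggsLattice.Site.tdist
  refine le_trans ?_ (Finset.le_sup (f := fun μ : Fin P.d => min (ybar μ - y μ).val (y μ - ybar μ).val) (Finset.mem_univ ν))
  show R₁ + 1 ≤ min (ybar ν - y ν).val (y ν - ybar ν).val
  rw [h2, h1]
  refine le_min ?_ ?_ <;> omega

/-- the centre lies in its cube. [cite: Balaban1982Higgs2, Lemma 2.4 proof p.572 «Let us define □₁, □₂ as the sums of large blocks contained in Λ₇^{(k−1)′} and distant from the point y less than 2r(Lᵏε), 4r(Lᵏε) respectively, and let us denote □ = Bᵏ(□₂). Of course □ ⊂ Bᵏ(Λ₂^{(k−1)′}).»] -/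
theorem mem_box_of_centre (q₁ ybar : HiggsLattice.Site P k) (R₁ : ℕ) (hybar : ∀ ν : Fin P.d, (ybar ν - q₁ ν).val = R₁) :
    ∀ ν : Fin P.d, (ybar ν - q₁ ν).val < 2 * R₁ + 1 := fun ν => by rw [hybar ν]; omega

/-- **(I.2.23)-FORM FROM THE GRADIENT BOUND**: `|A_{b′} − A_b| ≤ δA` and `Lᵏ(Lᵏε)|e|δA ≤ c_reg e_k^β` give
`(Lᵏε)|e|e_k⁻¹|A_{b′} − A_b| ≤ c_reg e_k^{β−1} L^{−k}`. [cite: Balaban1982Higgs1, Prop. 2.1 (2.23) p.610, p.611 l.1–2]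
[cite: Balaban1982Higgs2, (2.60) p.571] -/
theorem reg223_of_grad (C : ChargeData N) {δA creg β ec D : ℝ} (hec : 0 < ec)
    (hsmall : (P.L : ℝ) ^ k * P.mesh k * |C.e| * δA ≤ creg * ec ^ β) (hD : |D| ≤ δA) :
    P.mesh k * |C.e| / ec * |D| ≤ creg * ec ^ (β - 1) / (P.L : ℝ) ^ k := by
  have hLk : (0 : ℝ) < (P.L : ℝ) ^ k := pow_pos (by exact_mod_cast P.hL) k
  have hmesh : 0 < P.mesh k := P.mesh_pos k
  have h1 : P.mesh k * |C.e| / ec * |D| ≤ P.mesh k * |C.e| / ec * δA :=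
    mul_le_mul_of_nonneg_left hD (by positivity)
  refine h1.trans ?_
  rw [div_mul_eq_mul_div, div_le_div_iff₀ hec hLk, Real.rpow_sub_one hec.ne']
  calc P.mesh k * |C.e| * δA * (P.L : ℝ) ^ k = (P.L : ℝ) ^ k * P.mesh k * |C.e| * δA := by ring
    _ ≤ creg * ec ^ β := hsmall
    _ = creg * (ec ^ β / ec) * ec := by field_simp

end CentredBox

/-! ## §2 (2.65) with the centred box and one regularity hypothesis -/

section Eq265Centred

/-- **LEMMA 2.4 (2.65), VALUE CLAUSE, ON THE (Higgs)₂,₃ CARRIER — centred `□₁`, one regularity hypothesis.**  TYPED vs PRINTED: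
this is F7's `B2Eq265ConstantPart.eq265_higgs_region_reg` word for word except the located edits: `□₁ :=` the cube of coarse sites of
radius `R₁` centred at `ȳ = x_k` (binders `q₁ R₁`; F7's `S₁` instantiated at `2R₁ + 1`, so `2(2R₁+1) ≤ |T^{(k)}|_μ` and
`∀ y, y ∈ □₁ ↔ n_ν(y − q₁) < 2R₁+1`; `n_ν(ȳ − q₁) = R₁` replacing `ȳ ∈ □₁`), the binder `ρ` and its hypothesis REMOVED (`ρ ↦ R₁ + 1` at
every occurrence — the two exponentials —, by `tdist_ge_of_not_mem_box`), and the two regularity hypotheses on `A` ((I.2.23) form on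
`B^k(Λ₂)`, small-gradient form on `□`) REPLACED by the small-gradient form `|A_{⟨z+e_ν,μ⟩} − A_{⟨z,μ⟩}| ≤ δA` on `B^k(Λ₂)` with
`LᵏδA|e| ≤ t` and `Lᵏ(Lᵏε)|e|δA ≤ c_reg e_k^β`, `0 < e_k ≤ e₁` (`reg223_of_grad`). [cite: Balaban1982Higgs2, Lemma 2.4 (2.65) p.572]
[cite: Balaban1982Higgs2, Lemma 2.4 proof p.572 «Let us define □₁, □₂ as the sums of large blocks contained in Λ₇^{(k−1)′} and distant from the point y less than 2r(Lᵏε), 4r(Lᵏε) respectively, and let us denote □ = Bᵏ(□₂). Of course □ ⊂ Bᵏ(Λ₂^{(k−1)′}).»] -/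
theorem eq265_higgs_region_centred (d L : ℕ) (hd : 1 ≤ d) (hL : 2 ≤ L) {a : ℝ} (ha : 0 < a) {msq : ℝ} (hmsq : 0 < msq)
    (N : ℕ) (C : ChargeData N) (ε₀ : ℝ) (creg β : ℝ) (hcreg : 0 ≤ creg) (hβ : 0 < β) :
    ∃ K₀min : ℕ, ∀ K₀ : ℕ, K₀min ≤ K₀ → ∃ e₁ t : ℝ, 0 < e₁ ∧ 0 < t ∧
      ∃ C₁ C₂ C₃ D₁ D₂ D₃ D₄ : ℝ, 0 ≤ C₁ ∧ 0 ≤ C₂ ∧ 0 ≤ C₃ ∧ 0 ≤ D₁ ∧ 0 ≤ D₂ ∧ 0 ≤ D₃ ∧ 0 ≤ D₄ ∧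
      ∀ (P : HiggsLattice.Params), P.d = d → P.L = L → K₀ ∣ P.M →
      ∀ {k : ℕ}, 1 ≤ k → k ≤ P.K → (∀ μ, 3 * half P k K₀ ≤ P.sitesPerDir 0 μ) → P.mesh k ≤ ε₀ → P.mesh k ≤ 1 →
      ∀ (Λ₂ Λ₆ sq₂ sq₁ : Finset (HiggsLattice.Site P k)) (S : Fin P.d → Finset ℕ) (q : HiggsLattice.Site P k) (Sbox : ℕ),
        Λ₆ ⊆ Λ₂ → sq₂ ⊆ Λ₂ → sq₁ ⊆ sq₂ → sq₁ ⊆ Λ₆ →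
        IsBigBlockUnion k K₀ (underRegion k Λ₂) → underRegion k sq₂ = cellBox k K₀ S →
        (∀ μ : Fin P.d, P.L ^ k * Sbox < P.sitesPerDir 0 μ) →
      -- `□₂` IS the box `q + [0,S)ᵈ` of coarse sites, `□ = B^k(□₂)` smaller than half the torus
        (∀ y : HiggsLattice.Site P k, y ∈ sq₂ ↔ ∀ ν : Fin P.d, (y ν - q ν).val < Sbox) →
        (∀ μ : Fin P.d, 2 * (P.L ^ k * Sbox) ≤ P.sitesPerDir 0 μ) →
      -- `□₁` is the box of coarse sites of radius `R₁` about `ȳ` (corner `q₁`), smaller than half the torus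
      ∀ (q₁ : HiggsLattice.Site P k) (R₁ : ℕ), (∀ μ : Fin P.d, 2 * (2 * R₁ + 1) ≤ P.sitesPerDir k μ) →
        (∀ y : HiggsLattice.Site P k, y ∈ sq₁ ↔ ∀ ν : Fin P.d, (y ν - q₁ ν).val < 2 * R₁ + 1) →
      -- ONE regularity hypothesis: the small-gradient form on `B^k(Λ₂)`, small in the two printed scalings
      ∀ (A : HiggsLattice.VecField P 0) {δA : ℝ}, 0 ≤ δA →
          (∀ z ∈ underRegion k Λ₂, ∀ μ ν : Fin P.d, |A ⟨z.shift ν, μ⟩ - A ⟨z, μ⟩| ≤ δA) →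
          (P.L : ℝ) ^ k * δA * |C.e| ≤ t →
        ∀ {ec : ℝ}, 0 < ec → ec ≤ e₁ → (P.L : ℝ) ^ k * P.mesh k * |C.e| * δA ≤ creg * ec ^ β →
      ∀ (x : HiggsLattice.Site P 0),
        (∀ z, HiggsLattice.Site.tdist x z ≤ 2 * rS P k K₀ + 2 * half P k K₀ * (P.d + 1) + 1 → z ∈ underRegion k sq₂) →
        (∀ ν : Fin P.d, ((blockIter k x) ν - q₁ ν).val = R₁) →
      ∀ (φ : HiggsLattice.ScalarField P k N) {t' : ℝ}, 0 ≤ t' → (∀ y ∈ Λ₆, ‖φ y‖ ≤ t') →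
        -- the (2.55)₃-type covariant per-bond bound at `Ā^{(k)}` on the bonds of `□₁`
        ∀ {lamA : ℝ}, 0 ≤ lamA →
          (∀ (y : HiggsLattice.Site P k) (μ : Fin P.d), y ∈ sq₁ → y.shift μ ∈ sq₁ →
            ‖C.U (P.mesh k) (barA k A ⟨y, μ⟩) (φ (y.shift μ)) - φ y‖ ≤ lamA) →
        ‖bgScalar256 C msq a k Λ₂ Λ₆ A φ x - avgQkAdj C A k φ x‖
          ≤ B1.aSeq a P.L k * t' *
                (C₁ * Real.exp (-(1 / (4 * K₀) * (distC (underRegion k sq₂) x / (P.L : ℝ) ^ k)))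
                  + C₂ * Real.exp (-(1 / (4 * K₀) * ((R₁ : ℝ) + 1))))
            + (D₁ * P.mesh k ^ 2 *
                (B1.aSeq a P.L k * (P.mesh k)⁻¹ ^ 2 * (|C.e| * (δA * (P.d * ((P.L : ℝ) ^ k * Sbox))) * P.mesh 0 * (P.d * ((P.L : ℝ) ^ k - 1))) * t'
                  + |C.e| * (δA * (P.d * ((P.L : ℝ) ^ k * Sbox))) * (P.d * ((B1.aSeq a P.L k * (P.mesh k)⁻¹ ^ 2 * t' * D₄ * P.mesh k
                        + |C.e| * (δA * (P.d * ((P.L : ℝ) ^ k * Sbox))) * (B1.aSeq a P.L k * D₃ * t')) + |C.e| * (δA * (P.d * ((P.L : ℝ) ^ k * Sbox))) * (B1.aSeq a P.L k * D₃ * t')))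
                  + B1.aSeq a P.L k * (P.mesh k)⁻¹ ^ 2 *
                      ((2 * (|C.e| * (δA * (P.d * ((P.L : ℝ) ^ k * Sbox))) * P.mesh 0 * (P.d * ((P.L : ℝ) ^ k - 1)))
                        + (|C.e| * (δA * (P.d * ((P.L : ℝ) ^ k * Sbox))) * P.mesh 0 * (P.d * ((P.L : ℝ) ^ k - 1))) ^ 2) * (B1.aSeq a P.L k * D₃ * t')))
              + D₂ * P.mesh k * (|C.e| * (δA * (P.d * ((P.L : ℝ) ^ k * Sbox))) * (B1.aSeq a P.L k * D₃ * t')))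
            + B1.aSeq a P.L k * C₃ *
                (4 * K₀ * ((lamA + P.mesh k * |C.e| * (δA * (P.d * ((P.L : ℝ) ^ k * Sbox))) * t') * P.d) + Real.exp (-(1 / (4 * K₀) * ((R₁ : ℝ) + 1))) * t')
            + msq * P.mesh k ^ 2 / (B1.aSeq a P.L k + msq * P.mesh k ^ 2) * t'
            + |C.e| * P.mesh 0 * (P.d * ((P.L : ℝ) ^ k - 1)) * (δA * (P.d * ((P.L : ℝ) ^ k * Sbox))) * t' := by
  obtain ⟨K₀min, h⟩ := eq265_higgs_region_reg d L hd hL ha hmsq N C ε₀ creg β hcreg hβ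
  refine ⟨K₀min, fun K₀ hK₀ => ?_⟩
  obtain ⟨e₁, t, he₁, ht, C₁, C₂, C₃, D₁, D₂, D₃, D₄, hC₁, hC₂, hC₃, hD₁, hD₂, hD₃, hD₄, h⟩ := h K₀ hK₀
  refine ⟨e₁, t, he₁, ht, C₁, C₂, C₃, D₁, D₂, D₃, D₄, hC₁, hC₂, hC₃, hD₁, hD₂, hD₃, hD₄, ?_⟩
  intro P hPd hPL hK₀M k hk1 hkK h3 hε h1 Λ₂ Λ₆ sq₂ sq₁ S q Sbox h62 hs2 h12 h16 hΩΛ hbox hSbox hsq₂ h2S q₁ R₁ hS₁ hsq₁ A δA hδA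
    hgrad ht' ec hec hle hsmall x hx hcentre φ t' ht0 hφ lamA hlamA hcovA
  -- (I.2.23) form on `B^k(Λ₂)` and the gradient form on `□` from the single hypothesis
  have hreg : ∀ z ∈ underRegion k Λ₂, ∀ μ ν : Fin P.d,
      P.mesh k * |C.e| / ec * |A ⟨z.shift μ, ν⟩ - A ⟨z, ν⟩| ≤ creg * ec ^ (β - 1) / (P.L : ℝ) ^ k :=
    fun z hz μ ν => reg223_of_grad C hec hsmall (hgrad z hz ν μ)
  have hregbox : ∀ z ∈ underRegion k sq₂, ∀ μ ν : Fin P.d, |A ⟨z.shift ν, μ⟩ - A ⟨z, μ⟩| ≤ δA := by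
    intro z hz μ ν
    exact hgrad z ((mem_underRegion k Λ₂ z).mpr (hs2 ((mem_underRegion k sq₂ z).mp hz))) μ ν
  -- `ȳ ∈ □₁` and `ρ := R₁ + 1`
  have hxsq : blockIter k x ∈ sq₁ := (hsq₁ _).mpr (mem_box_of_centre q₁ (blockIter k x) R₁ hcentre)
  have hρ : ∀ y : HiggsLattice.Site P k, y ∉ sq₁ → ((R₁ : ℝ) + 1) ≤ (HiggsLattice.Site.tdist (blockIter k x) y : ℝ) := by
    intro y hy
    have h := tdist_ge_of_not_mem_box q₁ (blockIter k x) R₁ hcentre (fun hh => hy ((hsq₁ y).mpr hh))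
    exact_mod_cast h
  have hmain := h P hPd hPL hK₀M hk1 hkK h3 hε h1 Λ₂ Λ₆ sq₂ sq₁ S q Sbox h62 hs2 h12 h16 hΩΛ hbox hSbox hsq₂ h2S q₁ (2 * R₁ + 1) hS₁
    hsq₁ A hec hle hreg hδA hregbox ht' x hx hxsq φ ht0 hφ hlamA hcovA hρ
  rw [hPd] at hmain ⊢
  exact hmain

end Eq265Centred

end Literature.MathematicalPhysics.QuantumFieldTheory.Balaban1983to89.B2Eq265CentredBox

end
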